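/-
Copyright: cell `pub-ymgap` (HUMAN RULING D-0062), Track A of `YM-PLAN.md`, DAG node N20 (= NE7b); R134 acceleration seat
`pub-ymgap-dag-n20-c` (strategy s1, generation 5), module 30.  Released under the licence of the surrounding project.
-/
import Summits.QuantumFields.YangMills.Theorems.BalabanUVNodesN20LCSLabelTowerClassWeight
import HarnessLib

/-!
# YM-DAG node N20 (= NE7b), strategy s1, module 30: KEYS ROOTED AT A LATER STEP ON THE LABEL TOWER OF RECORD — the class of label histories whose
# level-`k` label pins the cubes `D` large weighs at most ONE PEIERLS FACTOR PER PINNED CUBE times the whole, CONDITIONAL ON EXACTLY «LCS-k»: the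
# local exponential plaquette moments of the level-`k` HISTORY-TERM STATES `eterm ρ₀ k h · dμ_k` (module 22's `hLS` shape) — the (α)-road's residual of
# Bałaban's kind, displayed ON THE OBJECT and nowhere else

Track A of `YM-PLAN.md` (cell `pub-ymgap`, HUMAN RULING D-0062), node **N20** = spine estimate NE7b (`T4WeightBudget.RelWeightBound` — NOT PRINTED,
NOT PROVED).  Seat `pub-ymgap-dag-n20-c` (R134, s1), generation 5, module 30 (after 27 = the label tower of record, 28 = the class weight bound for
keys rooted at the first step, 29 = the by-value junction).  Kernel theorems only: 0 `def`, 0 `sorry`, standard axioms; COUNT-NEUTRAL; `--supports` the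
K3⁗ item.  Nothing of Bałaban's is asserted.

WHY.  Module 28 closed the (α)-road's bookkeeping on the concrete tower for keys rooted at step `0`, where the history-term state is `ρ₀` itself and
«LCS-0» is g2's level-0 theorem (n20-d's cells Peierls bound).  For a key rooted at a later step `k` the road's one residual is «LCS-k» — the SAME local
exponential plaquette moment bound, but in the state of the level-`k` HISTORY TERM (g3 HANDOFF §2c ∕ g4 (A1c): «in the dressed state»).  Module 22 ∕ 23
proved «LCS-k (moment form, graph currency, Haar reference) ⇒ pinned hrel at step k» for ANY state.  THIS FILE moves that implication ONTO THE LABEL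
TOWER: (i) the level measures `lawOfRecord K k` are absolutely continuous w.r.t. Haar in the standing range (`HaarAC` of `Node00.avOfRecord`, iterated), so
a state against `μ_k` is a state against Haar with the Radon–Nikodym density and module 23's theorem applies to `(dμ_k∕dHaar_k)·eterm ρ₀ k h`; (ii) by
module 27's `hstep` and module 28's `labelChi_eq` the left side is the tower-currency sum over the pinned labels; (iii) the (α)-road's prefix induction
with ONE pinned level (`PrefixExtraction.sum_admS_integral_le_prod_filter`, free levels by module 28's `hpres`) gives the class bound.

WHAT.
* §1 `lawOfRecord_absolutelyContinuous` (`k ≤ K ⇒ μ_k ≪ Haar_k`), `integral_lawOfRecord_eq` (`∫ f dμ_k = ∫ (dμ_k∕dHaar_k)·f dHaar_k`), `rnDeriv_state_good`-type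
  facts (the density-weighted history term is a measurable, non-negative, Haar-integrable state).
* §2 ★★ **`sum_integral_op_pinned_le_of_LCS`** — THE PINNED DISPLAY `hrel` AT LEVEL `k` ON THE LABEL TOWER FROM «LCS-k»: for a history `h` of length `k`
  (`k < K`), if the state `eterm ρ₀ k h` under `μ_k` has local exponential plaquette moments `∫ e^{aβΣ_{q∈X}(1 − Re tr U(∂q))}·eterm dμ_k ≤ e^{Ca#X}·∫ eterm dμ_k`
  (`0 ≤ a ≤ a₀`, every plaquette set `X`), then for every label sub-family `E ⊆ {t | D ⊆ P(t)}`,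
  `Σ_{t ∈ E} ∫ (op k h ⟨k,t⟩).T (eterm ρ₀ k h) dμ_{k+1} ≤ (m·r_k)^{#D}·∫ eterm ρ₀ k h dμ_k` with module 22's rate `r_k` (one Peierls factor per pinned cube).
* §3 ★★★ **`sum_admS_integral_le_labelTower_pinnedLevel`** — THE CLASS WEIGHT BOUND FOR KEYS ROOTED AT LEVEL `k`: for a label-family pattern `E` that
  pins `D` at level `k` (`t ∈ E k h → D ⊆ P(t)`) and is FREE elsewhere (`E j h = univ`, `j ≠ k`), and a cutoff `K′ > k`, IF «LCS-k» holds for the states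
  of all pattern prefixes of length `k`, THEN `Σ_{h ∈ admS … (labelPattern E) K′} ∫ eterm ρ₀ K′ h dμ_{K′} ≤ (m·r_k)^{#D}·∫ ρ₀ dU₀`.

HONEST FRAMING.  The ONE displayed analytic hypothesis is «LCS-k» for the history-term states at level `k` (module 22's `hLS` shape with its window
`a ≤ a₀` and guard letters) — print's KIND ([Balaban1989LargeFieldI] (0.3)–(0.5) p. 176–177; [Balaban1989LargeFieldII] p. 383 l. 21–28), NOT print's
statement, NOT proved here (the (A1c) ∕ RR-1 object: these states carry the earlier labels' small-field constraints and large-field weights).  Other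
binders as in module 28 (the two ζ-laws, (O4) measurability, per-cube regularity letters — [Balaban1985Variational] Thm 1, NOT asserted —, disjoint letter
regions).  Conditional-expectation currency (module 27).  NE7b NOT PRINTED ∕ NOT PROVED; (α)-instance 0∕1; N20 NOT discharged; typed 28∕28, discharged
count untouched; one finite four-torus at fixed `ε` — NOT ℝ⁴, NOT infinite volume, NOT OS, NOT a mass gap, NOT Clay.

References (LOCATORS): T. Bałaban, CMP 119 (1988) 243–285 [Balaban1988Convergent] ((3.2)–(3.5) p. 265); CMP 122 (1989) 175–202 [Balaban1989LargeFieldI]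
((0.1) p. 175, (0.3)–(0.5) pp. 176–177); CMP 122 (1989) 355–392 [Balaban1989LargeFieldII] ((1.79)–(1.80) pp. 383–384); CMP 102 (1985) 277–309
[Balaban1985Variational] (Thm 1 p. 279).
-/

set_option autoImplicit false

noncomputable section

open scoped BigOperators ENNReal

namespace Summit.QuantumFields.YangMills.BalabanUVNodes.N20LCSLabelTowerPinnedLevel

open MeasureTheory
open Literature.MathematicalPhysics.QuantumFieldTheory.Balaban1983to89
open Literature.MathematicalPhysics.QuantumFieldTheory.Balaban1983to89.T4Continuum
open Literature.MathematicalPhysics.QuantumFieldTheory.Balaban1983to89.Node00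
open Summit.QuantumFields.BalabanUV.T4Continuum.B16HistoryIndexedRepr (GoodClass)
open Summit.QuantumFields.BalabanUV.T4Continuum.B16HistoryReprChain
open Summit.QuantumFields.BalabanUV.T4Continuum.NE7b.PrefixExtraction (admS admS_subset_adm sum_admS_integral_le_prod_filter)
open Summit.QuantumFields.YangMills.BalabanUVNodes.N20LCSLabelTower
open Summit.QuantumFields.YangMills.BalabanUVNodes.N20LCSLabelTowerClassWeight (labelChi_eq hpres_labelTower_eterm)
open Summit.QuantumFields.YangMills.BalabanUVNodes.N20LCSLargeFieldSubfamilies (abs_integral_pinnedSubfamily_le_of_moments)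
open Summit.QuantumFields.YangMills.BalabanUVNodes.N20LCSLargeFieldSparsify (zeta_nonneg_of_laws)
open ExpMeanLog (deltaSU)

variable (F : T4Family) (N : ℕ) [NeZero N]

/-! ## §1 The level measures are absolutely continuous w.r.t. Haar; states against them are Haar states with the Radon–Nikodym density -/

section AC

/-- In the standing range `k ≤ K` the law of the `k`-fold block average is absolutely continuous with respect to the Haar product measure of level
`k` (`HaarAC` of every averaging of record, `Node00.avOfRecord_haarAC`, iterated: `μ_{k+1} = μ_k.map avg_k ≪ Haar_k.map avg_k ≪ Haar_{k+1}`). [folklore] -/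
theorem lawOfRecord_absolutelyContinuous (K : ℕ) : ∀ k, k ≤ K → lawOfRecord F N K k ≪ fieldMeasure (F.P K) k (SU N)
  | 0, _ => by rw [lawOfRecord_zero]
  | k + 1, hk => by
      rw [lawOfRecord_succ]
      exact ((lawOfRecord_absolutelyContinuous K k (Nat.le_of_succ_le hk)).map (avOfRecord_measurable F N K k)).trans
        (avOfRecord_haarAC F N K k (Nat.lt_of_succ_le hk))

/-- **A STATE AGAINST THE LEVEL MEASURE IS A HAAR STATE WITH THE RADON–NIKODYM DENSITY**: for `k ≤ K` and every `f`,
`∫ f dμ_k = ∫ (dμ_k∕dHaar_k)·f dHaar_k` (`Measure.integral_toReal_rnDeriv_mul`). [folklore] -/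
theorem integral_lawOfRecord_eq (K k : ℕ) (hk : k ≤ K) (f : cfgOfRecord F N K k → ℝ) :
    ∫ U, f U ∂(lawOfRecord F N K k) =
      ∫ U, ((lawOfRecord F N K k).rnDeriv (fieldMeasure (F.P K) k (SU N)) U).toReal * f U ∂(fieldMeasure (F.P K) k (SU N)) :=
  (integral_toReal_rnDeriv_mul (lawOfRecord_absolutelyContinuous F N K k hk)).symm

/-- The Radon–Nikodym density of a level measure, as a real function, is measurable and non-negative. [folklore] -/
theorem measurable_rnDeriv_toReal (K k : ℕ) :
    Measurable fun U => ((lawOfRecord F N K k).rnDeriv (fieldMeasure (F.P K) k (SU N)) U).toReal :=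
  (Measure.measurable_rnDeriv _ _).ennreal_toReal

/-- The density-weighted version of a `μ_k`-integrable function is Haar-integrable (`k ≤ K`). [folklore] -/
theorem integrable_rnDeriv_mul (K k : ℕ) (hk : k ≤ K) {f : cfgOfRecord F N K k → ℝ} (hf : Integrable f (lawOfRecord F N K k)) :
    Integrable (fun U => ((lawOfRecord F N K k).rnDeriv (fieldMeasure (F.P K) k (SU N)) U).toReal * f U)
      (fieldMeasure (F.P K) k (SU N)) :=
  (integrable_toReal_rnDeriv_mul_iff (lawOfRecord_absolutelyContinuous F N K k hk)).2 hf

end AC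

/-! ## §2 «LCS-k» for the history-term state ⟹ the pinned display at level `k` on the label tower -/

section Pinned

variable (ν : Stage7Numerics) (M : ℕ) (p : B12.RunParams) (g : ℕ → ℝ) {A₁ : ℝ} {ζ : ZetaOfRecord F N ν M}

open Classical in
/-- ★★ **THE PINNED DISPLAY AT LEVEL `k` ON THE LABEL TOWER FROM «LCS-k».**  For `k < K`, `α > 0` in the transfer guard, the two ζ-laws, (O4)-measurable
label weights, a bounded measurable `ρ₀ ≥ 0`, a history `h` of length `k` whose term's state `eterm ρ₀ k h` under `μ_k` has LOCAL EXPONENTIAL PLAQUETTE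
MOMENTS — `∀ 0 ≤ a ≤ a₀, ∀ X, ∫ e^{aβΣ_{q∈X}(1 − Re tr U(∂q))}·eterm dμ_k ≤ e^{Ca#X}·∫ eterm dμ_k` («LCS-k» in the history term's own state, module 22's
shape) — a window `δ` with module 22's condition `hδ`, a finite family `D` of χ_{k+1}-cubes with regularity letters on pairwise disjoint regions of `≤ m`
plaquettes, `ε″ ≥ 0`, and EVERY label sub-family `E ⊆ {t | D ⊆ P(t)}`:
`Σ_{t ∈ E} ∫ (op k h ⟨k,t⟩).T (eterm ρ₀ k h) dμ_{k+1} ≤ (m·r_k)^{#D}·∫ eterm ρ₀ k h dμ_k`, `r_k` module 22's Peierls rate — the (α)-road's `hrel` at a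
pinned later level, in the TOWER's currency, for Bałaban's label tower, from «LCS-k» alone. [folklore] -/
theorem sum_integral_op_pinned_le_of_LCS (hζu : IsZetaUnity F N ν M ζ) (hζ : IsZetaAbsLeOne F N ν M ζ)
    (hω : ∀ (k : ℕ) (s : SeqOfRecord F ν M g p.K k) (t : LbOfRecord F ν p g k),
      Measurable fun z : cfgOfRecord F N p.K (k + 1) × cfgOfRecord F N p.K k => ωOfRecord F N ν M p g k A₁ ζ s t z.2 z.1)
    (k : ℕ) (hk : k < p.K) {α : ℝ} (hα : 0 < α)
    (hguard : (((((F.P p.K).d + 2) * (F.P p.K).L : ℕ) : ℝ) ^ 2 / 4) * Real.sqrt (2 * (Fintype.card (Fin N) : ℝ) * α) <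
      deltaSU (Fin N))
    {ρ₀ : cfgOfRecord F N p.K 0 → ℝ} (hρ : (bddMeas (cfgOfRecord F N p.K 0)).Gd ρ₀) (h0 : ∀ U, 0 ≤ ρ₀ U)
    (h : Fin k → LabelPat F ν p g) {β : ℝ} (hβ : 0 ≤ β) {C a₀ : ℝ} (hC : 0 ≤ C)
    (hLS : ∀ a : ℝ, 0 ≤ a → a ≤ a₀ → ∀ X : Finset (Plaq (F.P p.K) k),
      ∫ U, Real.exp (a * β * ∑ q ∈ X, (1 - reTr (GaugeField.plaqHol U q))) *
          (labelTowerOfRecord F N ν M p g A₁ ζ).eterm ρ₀ k h U ∂(lawOfRecord F N p.K k) ≤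
        Real.exp (C * a * X.card) * ∫ U, (labelTowerOfRecord F N ν M p g A₁ ζ).eterm ρ₀ k h U ∂(lawOfRecord F N p.K k))
    {δ : ℝ} (hδ0 : 0 ≤ δ)
    (hδ : δ * ((2 * (Fintype.card (Fin N) : ℝ) * (((F.P p.K).L : ℝ) ^ 2 + 6 * ((((F.P p.K).d + 2) * (F.P p.K).L : ℕ) : ℝ) ^ 2) ^ 2 + 2 / α) *
      (((2 * (((F.P p.K).d + 3) * (F.P p.K).L + 2) + 1) ^ (F.P p.K).d * (F.P p.K).d ^ 2 : ℕ) : ℝ)) ≤ a₀)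
    (D : Finset (Iχ F ν p g k)) (E : Finset (LbOfRecord F ν p g k)) (hE : ∀ t ∈ E, D ⊆ t.1)
    (R : Iχ F ν p g k → Finset (Plaq (F.P p.K) (k + 1))) (m : ℕ) {ε'' : ℝ} (hε : 0 ≤ ε'')
    (hm : ∀ c ∈ D, (R c).card ≤ m) (hdisj : ∀ c₁ ∈ D, ∀ c₂ ∈ D, c₁ ≠ c₂ → Disjoint (R c₁) (R c₂))
    (hreg : ∀ c ∈ D, ∀ V' : GaugeField (F.P p.K) (k + 1) (SU N),
      (∀ p' ∈ R c, dist1 (GaugeField.plaqHol V' p') < ε'') → chiFactor F N ν p g k c V' = 1) :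
    ∑ t ∈ E, ∫ V', ((labelTowerOfRecord F N ν M p g A₁ ζ).op k h ⟨k, t⟩).T
        ((labelTowerOfRecord F N ν M p g A₁ ζ).eterm ρ₀ k h) V' ∂(lawOfRecord F N p.K (k + 1)) ≤
      ((m : ℝ) * Real.exp (C * ((2 * (Fintype.card (Fin N) : ℝ) *
            (((F.P p.K).L : ℝ) ^ 2 + 6 * ((((F.P p.K).d + 2) * (F.P p.K).L : ℕ) : ℝ) ^ 2) ^ 2 + 2 / α) *
          (((2 * (((F.P p.K).d + 3) * (F.P p.K).L + 2) + 1) ^ (F.P p.K).d * (F.P p.K).d ^ 2 : ℕ) : ℝ)) *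
          (((2 * (((F.P p.K).d + 3) * (F.P p.K).L + 2) + 1) ^ (F.P p.K).d * (F.P p.K).d ^ 2 : ℕ) : ℝ) * δ -
            δ * β * (ε'' ^ 2 / (2 * (Fintype.card (Fin N) : ℝ))))) ^ D.card *
        ∫ U, (labelTowerOfRecord F N ν M p g A₁ ζ).eterm ρ₀ k h U ∂(lawOfRecord F N p.K k) := by
  -- abbreviations
  set T := labelTowerOfRecord F N ν M p g A₁ ζ with hT
  set e : cfgOfRecord F N p.K k → ℝ := T.eterm ρ₀ k h with he
  set dens : cfgOfRecord F N p.K k → ℝ := fun U => ((lawOfRecord F N p.K k).rnDeriv (fieldMeasure (F.P p.K) k (SU N)) U).toReal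
    with hdens
  have hk' : k ≤ p.K := hk.le
  have hegood : (bddMeas (cfgOfRecord F N p.K k)).Gd e := T.eterm_good hρ k h
  have he0 : ∀ U, 0 ≤ e U := fun U => T.eterm_nonneg hρ h0 k h U
  have heint : Integrable e (lawOfRecord F N p.K k) := integrable_of_bddMeas _ hegood
  -- the Haar state `f = dens · e`
  have hfm : Measurable fun U => dens U * e U := (measurable_rnDeriv_toReal F N p.K k).mul hegood.1
  have hf0 : ∀ U, 0 ≤ dens U * e U := fun U => mul_nonneg ENNReal.toReal_nonneg (he0 U)
  have hfi : Integrable (fun U => dens U * e U) (fieldMeasure (F.P p.K) k (SU N)) := integrable_rnDeriv_mul F N p.K k hk' heint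
  -- «LCS-k» transported to the Haar state
  have hLS' : ∀ a : ℝ, 0 ≤ a → a ≤ a₀ → ∀ X : Finset (Plaq (F.P p.K) k),
      ∫ U, Real.exp (a * β * ∑ q ∈ X, (1 - reTr (GaugeField.plaqHol U q))) * (dens U * e U) ∂(fieldMeasure (F.P p.K) k (SU N)) ≤
        Real.exp (C * a * X.card) * ∫ U, dens U * e U ∂(fieldMeasure (F.P p.K) k (SU N)) := by
    intro a ha ha0 X
    have e1 : ∫ U, Real.exp (a * β * ∑ q ∈ X, (1 - reTr (GaugeField.plaqHol U q))) * (dens U * e U) ∂(fieldMeasure (F.P p.K) k (SU N)) =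
        ∫ U, Real.exp (a * β * ∑ q ∈ X, (1 - reTr (GaugeField.plaqHol U q))) * e U ∂(lawOfRecord F N p.K k) := by
      rw [integral_lawOfRecord_eq F N p.K k hk']
      exact integral_congr_ae (ae_of_all _ fun U => by ring)
    have e2 : ∫ U, dens U * e U ∂(fieldMeasure (F.P p.K) k (SU N)) = ∫ U, e U ∂(lawOfRecord F N p.K k) :=
      (integral_lawOfRecord_eq F N p.K k hk' e).symm
    rw [e1, e2]
    exact hLS a ha ha0 X
  -- module 23's sub-family of-moments bound for the Haar state `dens · e`
  have h23 := abs_integral_pinnedSubfamily_le_of_moments F N ν M p g k hk hα hguard A₁ hζ (zeta_nonneg_of_laws F N ν M hζu hζ)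
    (seqOfHist F ν M p g k h) hfm hf0 hfi hβ hC hLS' hδ0 hδ D E hE R m hε hm hdisj hreg
  -- the left side in the tower's currency: `Σ_{t∈E} ∫ (op k h ⟨k,t⟩) e dμ_{k+1} = ∫ (Σ_{t∈E} ω (seqOfHist k h) t (U,Ū))·e dμ_k`
  have hlhs : ∑ t ∈ E, ∫ V', (T.op k h ⟨k, t⟩).T e V' ∂(lawOfRecord F N p.K (k + 1)) =
      ∫ U, (∑ t ∈ E, ωOfRecord F N ν M p g k A₁ ζ (seqOfHist F ν M p g k h) t U ((avOfRecord F N p.K k).avg U)) * (dens U * e U)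
        ∂(fieldMeasure (F.P p.K) k (SU N)) := by
    rw [Finset.sum_congr rfl fun t _ => hstep_labelTower F N ν M p g hω k h ⟨k, t⟩ e hegood,
      ← integral_finsetSum _ fun t _ => integrable_labelChi_mul_eterm F N ν M p g hω hρ k h ⟨k, t⟩,
      integral_lawOfRecord_eq F N p.K k hk']
    refine integral_congr_ae (ae_of_all _ fun U => ?_)
    simp only [Finset.sum_mul, Finset.mul_sum]
    refine Finset.sum_congr rfl fun t _ => ?_
    rw [labelChi_eq F N ν M p g A₁ hζu hζ, labelAt_mk]
    ring
  have hrhs : ∫ U, dens U * e U ∂(fieldMeasure (F.P p.K) k (SU N)) = ∫ U, e U ∂(lawOfRecord F N p.K k) :=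
    (integral_lawOfRecord_eq F N p.K k hk' e).symm
  rw [hlhs, ← hrhs]
  exact (le_abs_self _).trans h23

end Pinned

/-! ## §3 The class weight bound for keys rooted at level `k`, conditional on «LCS-k» for the prefix states -/

section ClassWeight

variable (ν : Stage7Numerics) (M : ℕ) (p : B12.RunParams) (g : ℕ → ℝ) {A₁ : ℝ} {ζ : ZetaOfRecord F N ν M}

open Classical in
/-- ★★★ **THE CLASS WEIGHT BOUND FOR KEYS ROOTED AT LEVEL `k` ON BAŁABAN's LABEL TOWER, CONDITIONAL ON «LCS-k».**  With the binders of §2 except the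
history, for a cutoff `K′ > k`, a label-family pattern `E` pinning `D` at level `k` (`t ∈ E k h → D ⊆ P(t)`) and FREE at every other level
(`E j h = univ` for `j ≠ k`), and a bounded measurable `ρ₀ ≥ 0`: IF every pattern prefix `h` of length `k` has a history-term state with local exponential
plaquette moments («LCS-k», module 22's shape, uniformly in `h`), THEN
`Σ_{h ∈ admS (labelTowerOfRecord A₁ ζ) (labelPattern E) K′} ∫ eterm ρ₀ K′ h dμ_{K′} ≤ (m·r_k)^{#D} · ∫ ρ₀ dU₀`
— `PrefixExtraction.sum_admS_integral_le_prod_filter` with the ONE pinned level `k` (§2) and module 28's `hpres` at the free levels: the histories whose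
level-`k` label pins `D` large weigh, at every later level, at most one Peierls factor per pinned cube times the whole, GIVEN «LCS-k» for the states of
the prefixes — the road's residual of Bałaban's kind, displayed on the object. [folklore] -/
theorem sum_admS_integral_le_labelTower_pinnedLevel (hζu : IsZetaUnity F N ν M ζ) (hζ : IsZetaAbsLeOne F N ν M ζ)
    (hω : ∀ (k : ℕ) (s : SeqOfRecord F ν M g p.K k) (t : LbOfRecord F ν p g k),
      Measurable fun z : cfgOfRecord F N p.K (k + 1) × cfgOfRecord F N p.K k => ωOfRecord F N ν M p g k A₁ ζ s t z.2 z.1)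
    (k : ℕ) (hk : k < p.K) {α : ℝ} (hα : 0 < α)
    (hguard : (((((F.P p.K).d + 2) * (F.P p.K).L : ℕ) : ℝ) ^ 2 / 4) * Real.sqrt (2 * (Fintype.card (Fin N) : ℝ) * α) <
      deltaSU (Fin N))
    {ρ₀ : cfgOfRecord F N p.K 0 → ℝ} (hρ : (bddMeas (cfgOfRecord F N p.K 0)).Gd ρ₀) (h0 : ∀ U, 0 ≤ ρ₀ U)
    {β : ℝ} (hβ : 0 ≤ β) {C a₀ : ℝ} (hC : 0 ≤ C)
    (E : (j : ℕ) → (Fin j → LabelPat F ν p g) → Finset (LbOfRecord F ν p g j))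
    (hLS : ∀ h : Fin k → LabelPat F ν p g, h ∈ admS (labelTowerOfRecord F N ν M p g A₁ ζ) (labelPattern F ν p g E) k →
      ∀ a : ℝ, 0 ≤ a → a ≤ a₀ → ∀ X : Finset (Plaq (F.P p.K) k),
        ∫ U, Real.exp (a * β * ∑ q ∈ X, (1 - reTr (GaugeField.plaqHol U q))) *
            (labelTowerOfRecord F N ν M p g A₁ ζ).eterm ρ₀ k h U ∂(lawOfRecord F N p.K k) ≤
          Real.exp (C * a * X.card) * ∫ U, (labelTowerOfRecord F N ν M p g A₁ ζ).eterm ρ₀ k h U ∂(lawOfRecord F N p.K k))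
    {δ : ℝ} (hδ0 : 0 ≤ δ)
    (hδ : δ * ((2 * (Fintype.card (Fin N) : ℝ) * (((F.P p.K).L : ℝ) ^ 2 + 6 * ((((F.P p.K).d + 2) * (F.P p.K).L : ℕ) : ℝ) ^ 2) ^ 2 + 2 / α) *
      (((2 * (((F.P p.K).d + 3) * (F.P p.K).L + 2) + 1) ^ (F.P p.K).d * (F.P p.K).d ^ 2 : ℕ) : ℝ)) ≤ a₀)
    (D : Finset (Iχ F ν p g k)) (hEk : ∀ h t, t ∈ E k h → D ⊆ t.1) (hEfree : ∀ j h, j ≠ k → E j h = Finset.univ)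
    (R : Iχ F ν p g k → Finset (Plaq (F.P p.K) (k + 1))) (m : ℕ) {ε'' : ℝ} (hε : 0 ≤ ε'')
    (hm : ∀ c ∈ D, (R c).card ≤ m) (hdisj : ∀ c₁ ∈ D, ∀ c₂ ∈ D, c₁ ≠ c₂ → Disjoint (R c₁) (R c₂))
    (hreg : ∀ c ∈ D, ∀ V' : GaugeField (F.P p.K) (k + 1) (SU N),
      (∀ p' ∈ R c, dist1 (GaugeField.plaqHol V' p') < ε'') → chiFactor F N ν p g k c V' = 1) (K' : ℕ) (hkK : k < K') :
    ∑ h' ∈ admS (labelTowerOfRecord F N ν M p g A₁ ζ) (labelPattern F ν p g E) K',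
        ∫ x, (labelTowerOfRecord F N ν M p g A₁ ζ).eterm ρ₀ K' h' x ∂(lawOfRecord F N p.K K') ≤
      ((m : ℝ) * Real.exp (C * ((2 * (Fintype.card (Fin N) : ℝ) *
            (((F.P p.K).L : ℝ) ^ 2 + 6 * ((((F.P p.K).d + 2) * (F.P p.K).L : ℕ) : ℝ) ^ 2) ^ 2 + 2 / α) *
          (((2 * (((F.P p.K).d + 3) * (F.P p.K).L + 2) + 1) ^ (F.P p.K).d * (F.P p.K).d ^ 2 : ℕ) : ℝ)) *
          (((2 * (((F.P p.K).d + 3) * (F.P p.K).L + 2) + 1) ^ (F.P p.K).d * (F.P p.K).d ^ 2 : ℕ) : ℝ) * δ -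
            δ * β * (ε'' ^ 2 / (2 * (Fintype.card (Fin N) : ℝ))))) ^ D.card *
        ∫ U, ρ₀ U ∂(fieldMeasure (F.P p.K) 0 (SU N)) := by
  set T := labelTowerOfRecord F N ν M p g A₁ ζ with hT
  -- the Peierls rate of the one pinned level
  set r : ℝ := ((m : ℝ) * Real.exp (C * ((2 * (Fintype.card (Fin N) : ℝ) *
            (((F.P p.K).L : ℝ) ^ 2 + 6 * ((((F.P p.K).d + 2) * (F.P p.K).L : ℕ) : ℝ) ^ 2) ^ 2 + 2 / α) *
          (((2 * (((F.P p.K).d + 3) * (F.P p.K).L + 2) + 1) ^ (F.P p.K).d * (F.P p.K).d ^ 2 : ℕ) : ℝ)) *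
          (((2 * (((F.P p.K).d + 3) * (F.P p.K).L + 2) + 1) ^ (F.P p.K).d * (F.P p.K).d ^ 2 : ℕ) : ℝ) * δ -
            δ * β * (ε'' ^ 2 / (2 * (Fintype.card (Fin N) : ℝ))))) ^ D.card with hr
  have hr0 : 0 ≤ r := pow_nonneg (mul_nonneg (Nat.cast_nonneg m) (Real.exp_pos _).le) _
  -- the rate family: `r` at the pinned level, irrelevant elsewhere
  have key := sum_admS_integral_le_prod_filter T (labelPattern F ν p g E) (lawOfRecord F N p.K) ρ₀ (ε := fun _ => r) {k}
    (fun _ _ => hr0) K'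
    (fun j h' hj hjk hh' => by
      have hjk' : j = k := Finset.mem_singleton.1 hjk
      subst hjk'
      -- the pinned level: §2 with the sub-family `E j h'`
      rw [branch_inter_labelPattern, sum_labelPattern]
      exact sum_integral_op_pinned_le_of_LCS F N ν M p g hζu hζ hω j hk hα hguard hρ h0 h' hβ hC (hLS h' hh') hδ0 hδ D (E j h')
        (hEk h') R m hε hm hdisj hreg)
    (fun j h' _ hjk => by
      have hjk' : j ≠ k := fun e => hjk (Finset.mem_singleton.2 e)
      intro q hq
      rw [labelPattern, hEfree j h' hjk']
      exact hq)
    (fun j h' q _ _ _ _ => integrable_op_eterm F N ν M p g hρ j h' q)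
    (fun j h' _ _ _ => hpres_labelTower_eterm F N ν M p g A₁ hζu hζ hω hρ j h')
  rw [lawOfRecord_zero] at key
  refine key.trans ?_
  refine mul_le_mul_of_nonneg_right (le_of_eq ?_) (integral_nonneg h0)
  -- past the pinned level the filtered product is the single factor `r`
  have hfilter : (Finset.range K').filter (· ∈ ({k} : Finset ℕ)) = {k} := by
    ext j
    simp only [Finset.mem_filter, Finset.mem_range, Finset.mem_singleton]
    constructor
    · rintro ⟨_, rfl⟩; rfl
    · rintro rfl; exact ⟨hkK, rfl⟩
  rw [hfilter, Finset.prod_singleton]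

end ClassWeight

end Summit.QuantumFields.YangMills.BalabanUVNodes.N20LCSLabelTowerPinnedLevel

end
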